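import Literature.AlgebraicGeometry.ShimuraVarieties.HermitianNegConeOrbitDensity   -- ★ Witt for anisotropic vectors: `exists_unitary_mulVec_eq`
import Literature.MeasureTheory.Group.ConjClassLocallyClosedEmbedding                -- ★ Glimm–Effros: `isHomeomorph_orbitEquivQuotientStabilizer_symm_of_isLocallyClosed`
import Literature.MeasureTheory.Group.InvariantQuotientExistence                      -- ★ `exists_isCompact_image_mk_superset` (compact sets of `G ⧸ H` lift)
import Literature.NumberTheory.Automorphic.UnitaryFormGroupUnimodular                 -- ★ `isClosed∕locallyCompactSpace∕secondCountableTopology_unitaryGroupOfForm_complex`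
import HarnessLib

/-!
# Harish-Chandra's compactness lemma at a semi-regular point of `U(J)(ℂ)`: uniform properness of a torus chart MODULO the stabiliser
# of a non-isotropic common eigenline, across the walls of the other eigenvalues
# (Rogawski 1990 §4.12 Lemma 4.12.1, §8.2; Harish-Chandra–van Dijk 1970 Part I §3 Lemma 22; Varadarajan 1977 Part II §2; Deitmar–Echterhoff 2014 Lemma 9.3.3)

Topic `NumberTheory/Automorphic`; namespace `Literature.NumberTheory.Automorphic.UnitaryGroup`.  THEOREMS ONLY (no `def`, no instance, no notation,
no axiom, no named fact, no `sorry`).  Cell `pub/hodgecm-mathlib`, crux H413 (`stmt-HodgeConjecture-24833`), F0∕P3c line LH3 (closer stub `stub_N9`, DIRECT ROAD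
«Transf», organ J (J-UNIV)), brick **(J-DESC) FILE D1** (LH3-plan (g2) OPEN BRICKS 2026-09-02T06:54:46Z; seat F0P3a-p08 (g22)): the topological half of the
semisimple DESCENT of orbital integrals at a singular elliptic point `s` — the «compact modulo `M`» hypothesis of ★
`Literature.MeasureTheory.Group.orbitalIntegral_eq_orbitalIntegral_descended` (p08 (g13)), UNIFORMLY on a neighbourhood of `s`, in the (HYP) currency of ★
`Literature.MeasureTheory.Group.continuousOn_integral_descConj_of_uniformlyProper`.

THE MATHEMATICS.  `U = U(J)(ℂ) = {g ∈ GL_n(ℂ) ∣ gᴴ J g = J}` (★ `unitaryGroupOfForm (starRingEnd ℂ) J`), `J` hermitian and invertible; `e ∈ ℂⁿ` with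
`⟪e,e⟫ = eᴴ J e ≠ 0`; `E_e := ⟪e,e⟫⁻¹ · e (eᴴ J)` the `J`-orthogonal projector onto `ℂe`.  Three facts:
* (§1, ALGEBRA) for `g ∈ U`: `g · e(eᴴJ) · g⁻¹ = (ge)((ge)ᴴ J)` (because `J g⁻¹ = gᴴ J`), `⟪ge, ge⟫ = ⟪e, e⟫`, and `v(vᴴJ) · J⁻¹ = v vᴴ` has diagonal `|vᵢ|²`:
  so if `g E_e g⁻¹` stays in a compact set of matrices then `ge` stays in a ball (`exists_forall_norm_le_of_vecMulVec_mem`).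
* (§2, TOPOLOGY) the orbit `U · e` is the LEVEL SET `{v ∣ ⟪v,v⟫ = ⟪e,e⟫}` (★ Witt `exists_unitary_mulVec_eq`, one hermitian reflection), which is closed in `ℂⁿ`; `U` is
  σ-compact (★ `locallyCompactSpace∕secondCountableTopology_unitaryGroupOfForm_complex`); so by Glimm–Effros (★
  `isHomeomorph_orbitEquivQuotientStabilizer_symm_of_isLocallyClosed`) `U ⧸ Stab(e) → U · e` is a HOMEOMORPHISM and «`ge` in a compact» ⇒ «`g Stab(e)` in a compact of
  `U ⧸ Stab(e)`» ⇒ the same modulo any `M ≥ Stab(e)`, and at group level `g ∈ C · M` with `C ⊆ U` compact (★ `exists_isCompact_image_mk_superset`).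
* (§3, THE LEMMA) a chart `c : X → U` admitting on `S ⊆ X` a CONJUGATION-EQUIVARIANT CONTINUOUS MARKER `F : X → M_n(ℂ) → M_n(ℂ)` with `F x (c x) = E_e` (§4 and the sequel
  file: the Lagrange eigenprojector polynomial of a framed diagonal chart whose eigenvalue on `e` is SIMPLE on `S` — collisions among the OTHER eigenvalues allowed, which
  is the point: `S ∋ s`) is UNIFORMLY PROPER MODULO `M` on `S` for every `M ≥ Stab(e)`: `y·c(x)·y⁻¹ ∈ C`, `x ∈ K` ⇒ `y E_e y⁻¹ = F x (y c(x) y⁻¹) ∈ F(K × C)` compact ⇒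
  `ye` bounded ⇒ `yM` in a compact (`uniformlyProper_of_marker`, (HYP) binder shape verbatim; group-level form `exists_isCompact_mul_of_marker`).
For `G′_w = U(2,1)`, `s` elliptic with a double eigenvalue on the plane `ℓ₁ ⊕ ℓ₂` and `e ∈ ℓ₃`: `M = Z(s) = U(ℓ₁ ⊕ ℓ₂) × U(ℓ₃) ≥ Stab(e)` and the lemma is Harish-Chandra's
«compactness lemma» feeding the descent `Φ^{G′}(t, ψ) = Φ^{M}(t, ψ_M)` for ALL `t` near `s` with ONE cut-off — hence the `G′`-side jump at the wall through `s` is a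
`U(1,1)`-jump (★ (K0±)-U11 `ArchRankOneJumpZero`).
* §1 `conjTranspose_mul_mul_eq_of_mem`, `mul_coe_inv_eq_conjTranspose_mul_of_mem`, `conj_vecMulVec_eq_of_mem`, `star_mulVec_dotProduct_mulVec_eq_of_mem`,
  `exists_forall_norm_le_of_vecMulVec_mem`;
* §2 `continuousSMul_unitaryGroupOfForm_vec`, `orbit_eq_setOf_dotProduct_eq`, `isClosed_orbit_vec`, **`exists_isCompact_quotient_stabilizer_of_smul_mem`**,
  `exists_isCompact_quotient_of_smul_mem` (any `M ≥ Stab(e)`), `exists_isCompact_mul_of_smul_mem` (group level);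
* §3 **`uniformlyProper_of_marker`**, **`exists_isCompact_mul_of_marker`**;
* §4 `conj_list_prod_sub_smul_one` (conjugation-equivariance of `m ↦ ∏ⱼ (m − μⱼ·1)`), `continuous_list_prod_sub_smul_one`.
HONEST LABEL: HC_CM is proved only modulo the 7 printed citations (2 remaining named inputs: hLiu418 = `stmt-HodgeConjecture-24832`, h413 = `stmt-HodgeConjecture-24833`)
until rung 0 closes; this file is count-neutral topology under organ J of `stub_N9` and pays nothing by itself.

## References
* [Rogawski1990] J. D. Rogawski, *Automorphic Representations of Unitary Groups in Three Variables*, Ann. of Math. Stud. 123 (1990), §4.12 Lemma 4.12.1 p. 66 («there is a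
  neighborhood `V` of `1` in `M` such that … the image of `{g ∣ g⁻¹ V δ₀ ε(g) ∩ Ω ≠ ∅}` in `Z̃M ∖ G̃` is compact» — the compactness lemma, there in the twisted setting after
  [AC] p. 20) and §8.2 p. 114 (its use: «the set `S = {g ∣ f(g⁻¹δγg) ≠ 0 for some δ ∈ V}` is compact modulo `H`», the descended function `f₁`); §3.6 p. 31.
* [HarishChandra1970] Harish-Chandra (notes by G. van Dijk), *Harmonic Analysis on Reductive p-adic Groups*, LNM 162 (1970), Part I §3 Lemma 22 (the compactness lemma behind
  the descent `Φ^G(t, ψ) = Φ^M(t, ψ_M)`, Lemmas 22–23).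
* [Varadarajan1977] V. S. Varadarajan, *Harmonic Analysis on Real Reductive Groups*, LNM 576 (1977), Part II §2 (semi-regular points, descent to `𝔷`-centralisers).
* [DeitmarEchterhoff2014] A. Deitmar, S. Echterhoff, *Principles of Harmonic Analysis*, 2nd ed. (2014), Lemma 9.3.3, Remark 1.5.2, Thm. 4.2.10 (Glimm–Effros).
* [Jacobson] N. Jacobson, *Lectures in Abstract Algebra II*, Ch. V §11 p. 162 (Witt's theorem; anisotropic vectors).
-/

set_option autoImplicit false

noncomputable section

open Matrix MulAction Topology Set
open scoped MatrixGroups ComplexConjugate Pointwise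

namespace Literature.NumberTheory.Automorphic.UnitaryGroup

/-! ## §1 Algebra: the `J`-projector marker `e (eᴴ J)` under `U(J)`-conjugation, and the bound it carries -/

section Algebra

variable {n : Type*} [Fintype n] [DecidableEq n] {J : Matrix n n ℂ}

/-- `g ∈ U(J)(ℂ)` iff-direction used here: `gᴴ J g = J`. [cite: Rogawski1990, §3.6 p. 31] -/
theorem conjTranspose_mul_mul_eq_of_mem {g : GL n ℂ} (hg : g ∈ unitaryGroupOfForm (starRingEnd ℂ) J) :
    (g : Matrix n n ℂ)ᴴ * J * (g : Matrix n n ℂ) = J := by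
  have h := mem_unitaryGroupOfForm_iff.1 hg
  have e : ((g : Matrix n n ℂ).map (starRingEnd ℂ))ᵀ = (g : Matrix n n ℂ)ᴴ := by
    ext i j; rfl
  rwa [e] at h

/-- For `g ∈ U(J)(ℂ)`: `J · g⁻¹ = gᴴ · J`. [cite: Rogawski1990, §3.6 p. 31] -/
theorem mul_coe_inv_eq_conjTranspose_mul_of_mem {g : GL n ℂ} (hg : g ∈ unitaryGroupOfForm (starRingEnd ℂ) J) :
    J * ((g⁻¹ : GL n ℂ) : Matrix n n ℂ) = (g : Matrix n n ℂ)ᴴ * J := by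
  have h := conjTranspose_mul_mul_eq_of_mem hg
  calc J * ((g⁻¹ : GL n ℂ) : Matrix n n ℂ)
      = (g : Matrix n n ℂ)ᴴ * J * (g : Matrix n n ℂ) * ((g⁻¹ : GL n ℂ) : Matrix n n ℂ) := by rw [h]
    _ = (g : Matrix n n ℂ)ᴴ * J * ((g : Matrix n n ℂ) * ((g⁻¹ : GL n ℂ) : Matrix n n ℂ)) := by simp only [Matrix.mul_assoc]
    _ = (g : Matrix n n ℂ)ᴴ * J := by rw [Units.mul_inv, Matrix.mul_one]

/-- **The marker identity**: for `g ∈ U(J)(ℂ)` and any `e`, `g · e(eᴴ J) · g⁻¹ = (ge)((ge)ᴴ J)` — conjugating the (un-normalised) `J`-projector onto `ℂe` gives the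
`J`-projector onto `ℂ ge`. [cite: Rogawski1990, §4.12 Lemma 4.12.1 p. 66] [cite: Varadarajan1977, Part II §2] -/
theorem conj_vecMulVec_eq_of_mem {g : GL n ℂ} (hg : g ∈ unitaryGroupOfForm (starRingEnd ℂ) J) (e : n → ℂ) :
    (g : Matrix n n ℂ) * vecMulVec e (star e ᵥ* J) * ((g⁻¹ : GL n ℂ) : Matrix n n ℂ) =
      vecMulVec ((g : Matrix n n ℂ) *ᵥ e) (star ((g : Matrix n n ℂ) *ᵥ e) ᵥ* J) := by
  rw [mul_vecMulVec, vecMulVec_mul, Matrix.vecMul_vecMul, mul_coe_inv_eq_conjTranspose_mul_of_mem hg, star_mulVec,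
    Matrix.vecMul_vecMul]

/-- `U(J)(ℂ)` preserves the form: `⟪ge, ge⟫ = ⟪e, e⟫`. [cite: Jacobson, Ch. V §11 p. 162] -/
theorem star_mulVec_dotProduct_mulVec_eq_of_mem {g : GL n ℂ} (hg : g ∈ unitaryGroupOfForm (starRingEnd ℂ) J) (e : n → ℂ) :
    star ((g : Matrix n n ℂ) *ᵥ e) ⬝ᵥ J *ᵥ ((g : Matrix n n ℂ) *ᵥ e) = star e ⬝ᵥ J *ᵥ e := by
  rw [star_mulVec, Matrix.dotProduct_mulVec, Matrix.vecMul_vecMul, Matrix.dotProduct_mulVec, Matrix.vecMul_vecMul,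
    conjTranspose_mul_mul_eq_of_mem hg, ← Matrix.dotProduct_mulVec]

/-- `v(vᴴ J) · J′ = v vᴴ` for a right inverse `J J′ = 1`. [folklore] -/
private theorem vecMulVec_star_vecMul_mul_eq {J' : Matrix n n ℂ} (hJJ' : J * J' = 1) (v : n → ℂ) :
    vecMulVec v (star v ᵥ* J) * J' = vecMulVec v (star v) := by
  rw [vecMulVec_mul, Matrix.vecMul_vecMul, hJJ', Matrix.vecMul_one]

/-- **The bound carried by the marker**: if the matrices `v (vᴴ J)` lie in a compact set `𝒞 ⊆ M_n(ℂ)` (`J` with a right inverse), the vectors `v` lie in a ball —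
the diagonal of `v(vᴴJ)J′ = v vᴴ` is `(|vᵢ|²)ᵢ`. [cite: Rogawski1990, §4.12 Lemma 4.12.1 p. 66] [cite: HarishChandra1970, Part I §3 Lemma 22] [cite: Varadarajan1977, Part II §2] -/
theorem exists_forall_norm_le_of_vecMulVec_mem {J' : Matrix n n ℂ} (hJJ' : J * J' = 1) {𝒞 : Set (Matrix n n ℂ)} (h𝒞 : IsCompact 𝒞) :
    ∃ R : ℝ, 0 ≤ R ∧ ∀ v : n → ℂ, vecMulVec v (star v ᵥ* J) ∈ 𝒞 → ‖v‖ ≤ R := by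
  -- the continuous function `P ↦ Σᵢ ‖(P J′)ᵢᵢ‖` is bounded on `𝒞`
  have hmul : Continuous fun P : Matrix n n ℂ => P * J' := continuous_id.mul continuous_const
  have hf : Continuous fun P : Matrix n n ℂ => ∑ i, ‖(P * J') i i‖ :=
    continuous_finsetSum _ fun i _ => ((continuous_apply i).comp ((continuous_apply i).comp hmul)).norm
  obtain ⟨B, hB⟩ := (h𝒞.image hf).isBounded.subset_closedBall 0
  have hB' : ∀ P ∈ 𝒞, ∑ i, ‖(P * J') i i‖ ≤ max B 0 := by
    intro P hP
    have h := hB ⟨P, hP, rfl⟩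
    rw [Metric.mem_closedBall, dist_zero_right, Real.norm_eq_abs] at h
    exact (le_abs_self _).trans (h.trans (le_max_left _ _))
  refine ⟨Real.sqrt (max B 0), Real.sqrt_nonneg _, fun v hv => ?_⟩
  have hsum : ∑ i, ‖(vecMulVec v (star v ᵥ* J) * J') i i‖ = ∑ i, ‖v i‖ ^ 2 := by
    refine Finset.sum_congr rfl fun i _ => ?_
    rw [vecMulVec_star_vecMul_mul_eq hJJ', vecMulVec_apply, Pi.star_apply, Complex.star_def, Complex.mul_conj,
      Complex.norm_of_nonneg (Complex.normSq_nonneg _), Complex.normSq_eq_norm_sq]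
  have hle : ∑ i, ‖v i‖ ^ 2 ≤ max B 0 := hsum ▸ hB' _ hv
  refine (pi_norm_le_iff_of_nonneg (Real.sqrt_nonneg _)).2 fun i => ?_
  rw [← Real.sqrt_sq (norm_nonneg (v i))]
  exact Real.sqrt_le_sqrt ((Finset.single_le_sum (fun j _ => sq_nonneg ‖v j‖) (Finset.mem_univ i)).trans hle)

end Algebra

/-! ## §2 Topology: the orbit of a non-isotropic vector is a closed level set; compactness modulo the stabiliser -/

section Orbit

variable {n : Type*} [Fintype n] [DecidableEq n] {J : Matrix n n ℂ}

/-- The converse membership: `gᴴ J g = J ⇒ g ∈ U(J)(ℂ)`. [cite: Rogawski1990, §3.6 p. 31] -/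
theorem mem_of_conjTranspose_mul_mul_eq {g : GL n ℂ} (hg : (g : Matrix n n ℂ)ᴴ * J * (g : Matrix n n ℂ) = J) :
    g ∈ unitaryGroupOfForm (starRingEnd ℂ) J := by
  rw [mem_unitaryGroupOfForm_iff]
  have e : ((g : Matrix n n ℂ).map (starRingEnd ℂ))ᵀ = (g : Matrix n n ℂ)ᴴ := by
    ext i j; rfl
  rwa [e]

/-- The action of `U(J)(ℂ)` on `ℂⁿ` (through `GL_n(ℂ)`, `g • v = g v`) unfolded. [folklore] -/
private theorem subgroup_smul_vec_eq (g : ↥(unitaryGroupOfForm (starRingEnd ℂ) J)) (v : n → ℂ) :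
    g • v = ((g : GL n ℂ) : Matrix n n ℂ) *ᵥ v := rfl

/-- The action of `U(J)(ℂ)` on `ℂⁿ` is continuous. [cite: DeitmarEchterhoff2014, Lemma 9.3.3] -/
theorem continuousSMul_unitaryGroupOfForm_vec : ContinuousSMul ↥(unitaryGroupOfForm (starRingEnd ℂ) J) (n → ℂ) := by
  refine ⟨?_⟩
  have h : Continuous fun p : ↥(unitaryGroupOfForm (starRingEnd ℂ) J) × (n → ℂ) => ((p.1 : GL n ℂ) : Matrix n n ℂ) *ᵥ p.2 :=
    (Units.continuous_val.comp (continuous_subtype_val.comp continuous_fst)).matrix_mulVec continuous_snd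
  exact h

/-- **The orbit of a non-isotropic `e` under `U(J)(ℂ)` is the level set `{v ∣ ⟪v,v⟫ = ⟪e,e⟫}`** (`⊇`: ★ Witt `exists_unitary_mulVec_eq`, one hermitian reflection;
`⊆`: the form is preserved). [cite: Jacobson, Ch. V §11 p. 162] -/
theorem orbit_eq_setOf_dotProduct_eq (hJ : J.IsHermitian) {e : n → ℂ} (he : star e ⬝ᵥ J *ᵥ e ≠ 0) :
    orbit ↥(unitaryGroupOfForm (starRingEnd ℂ) J) e = {v : n → ℂ | star v ⬝ᵥ J *ᵥ v = star e ⬝ᵥ J *ᵥ e} := by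
  ext v
  constructor
  · rintro ⟨g, rfl⟩
    exact star_mulVec_dotProduct_mulVec_eq_of_mem g.2 e
  · intro hv
    obtain ⟨g, hgJ, hge⟩ := Literature.AlgebraicGeometry.ShimuraVarieties.exists_unitary_mulVec_eq hJ (v := e) (w := v) hv.symm he
    exact ⟨⟨g, mem_of_conjTranspose_mul_mul_eq hgJ⟩, hge⟩

/-- The orbit of a non-isotropic vector is closed in `ℂⁿ`. [cite: Jacobson, Ch. V §11 p. 162] -/
theorem isClosed_orbit_vec (hJ : J.IsHermitian) {e : n → ℂ} (he : star e ⬝ᵥ J *ᵥ e ≠ 0) :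
    IsClosed (orbit ↥(unitaryGroupOfForm (starRingEnd ℂ) J) e) := by
  rw [orbit_eq_setOf_dotProduct_eq hJ he]
  exact isClosed_eq (continuous_star.dotProduct (continuous_const.matrix_mulVec continuous_id)) continuous_const

/-- **Compactness modulo the stabiliser (Glimm–Effros on the closed orbit).**  For a compact `B ⊆ ℂⁿ` there is a compact `𝒦 ⊆ U ⧸ Stab(e)` containing `g Stab(e)`
whenever `g e ∈ B`: the orbit map `U ⧸ Stab(e) → U·e` is a homeomorphism onto the closed orbit (★ `isHomeomorph_orbitEquivQuotientStabilizer_symm_of_isLocallyClosed`; `U` is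
σ-compact). [cite: DeitmarEchterhoff2014, Thm. 4.2.10; Lemma 9.3.3] [cite: Rogawski1990, §4.12 Lemma 4.12.1 p. 66] [cite: HarishChandra1970, Part I §3 Lemma 22] -/
theorem exists_isCompact_quotient_stabilizer_of_smul_mem (hJ : J.IsHermitian) {e : n → ℂ} (he : star e ⬝ᵥ J *ᵥ e ≠ 0)
    {B : Set (n → ℂ)} (hB : IsCompact B) :
    ∃ 𝒦 : Set (↥(unitaryGroupOfForm (starRingEnd ℂ) J) ⧸ stabilizer ↥(unitaryGroupOfForm (starRingEnd ℂ) J) e),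
      IsCompact 𝒦 ∧ ∀ g : ↥(unitaryGroupOfForm (starRingEnd ℂ) J), g • e ∈ B →
        (QuotientGroup.mk g : ↥(unitaryGroupOfForm (starRingEnd ℂ) J) ⧸ stabilizer ↥(unitaryGroupOfForm (starRingEnd ℂ) J) e) ∈ 𝒦 := by
  haveI : ContinuousSMul ↥(unitaryGroupOfForm (starRingEnd ℂ) J) (n → ℂ) := continuousSMul_unitaryGroupOfForm_vec
  haveI : LocallyCompactSpace ↥(unitaryGroupOfForm (starRingEnd ℂ) J) := locallyCompactSpace_unitaryGroupOfForm_complex J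
  haveI : SecondCountableTopology ↥(unitaryGroupOfForm (starRingEnd ℂ) J) := secondCountableTopology_unitaryGroupOfForm_complex J
  have hO : IsLocallyClosed (orbit ↥(unitaryGroupOfForm (starRingEnd ℂ) J) e) := (isClosed_orbit_vec hJ he).isLocallyClosed
  have hφ := Literature.MeasureTheory.Group.isHomeomorph_orbitEquivQuotientStabilizer_symm_of_isLocallyClosed
    (G := ↥(unitaryGroupOfForm (starRingEnd ℂ) J)) hO
  have hB' : IsCompact (Subtype.val ⁻¹' B : Set (orbit ↥(unitaryGroupOfForm (starRingEnd ℂ) J) e)) :=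
    (isClosed_orbit_vec hJ he).isClosedEmbedding_subtypeVal.isCompact_preimage hB
  refine ⟨((orbitEquivQuotientStabilizer ↥(unitaryGroupOfForm (starRingEnd ℂ) J) e).symm) ⁻¹' (Subtype.val ⁻¹' B),
    hφ.isClosedEmbedding.isCompact_preimage hB', fun g hg => ?_⟩
  rw [Set.mem_preimage, Set.mem_preimage, orbitEquivQuotientStabilizer_symm_apply]
  exact hg

/-- **The same modulo any `M ≥ Stab(e)`** (push forward along `U ⧸ Stab(e) → U ⧸ M`). [cite: DeitmarEchterhoff2014, Lemma 9.3.3] -/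
theorem exists_isCompact_quotient_of_smul_mem (hJ : J.IsHermitian) {e : n → ℂ} (he : star e ⬝ᵥ J *ᵥ e ≠ 0)
    (M : Subgroup ↥(unitaryGroupOfForm (starRingEnd ℂ) J)) (hM : stabilizer ↥(unitaryGroupOfForm (starRingEnd ℂ) J) e ≤ M)
    {B : Set (n → ℂ)} (hB : IsCompact B) :
    ∃ 𝒦 : Set (↥(unitaryGroupOfForm (starRingEnd ℂ) J) ⧸ M), IsCompact 𝒦 ∧
      ∀ g : ↥(unitaryGroupOfForm (starRingEnd ℂ) J), g • e ∈ B → (QuotientGroup.mk g : ↥(unitaryGroupOfForm (starRingEnd ℂ) J) ⧸ M) ∈ 𝒦 := by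
  obtain ⟨𝒦₀, h𝒦₀, hmem⟩ := exists_isCompact_quotient_stabilizer_of_smul_mem hJ he hB
  have hcont : Continuous (Subgroup.quotientMapOfLE hM) := by
    rw [QuotientGroup.isOpenQuotientMap_mk.isQuotientMap.continuous_iff]
    exact QuotientGroup.continuous_mk
  exact ⟨Subgroup.quotientMapOfLE hM '' 𝒦₀, h𝒦₀.image hcont, fun g hg => ⟨QuotientGroup.mk g, hmem g hg, rfl⟩⟩

/-- **Group-level form**: a compact `C ⊆ U` with `g ∈ C · M` whenever `g e ∈ B` (compact sets of `U ⧸ M` lift, ★ `exists_isCompact_image_mk_superset`) — the shape of the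
«compact modulo `M`» hypothesis of ★ `orbitalIntegral_eq_orbitalIntegral_descended`. [cite: DeitmarEchterhoff2014, Remark 1.5.2; Lemma 9.3.3] -/
theorem exists_isCompact_mul_of_smul_mem (hJ : J.IsHermitian) {e : n → ℂ} (he : star e ⬝ᵥ J *ᵥ e ≠ 0)
    (M : Subgroup ↥(unitaryGroupOfForm (starRingEnd ℂ) J)) (hM : stabilizer ↥(unitaryGroupOfForm (starRingEnd ℂ) J) e ≤ M)
    {B : Set (n → ℂ)} (hB : IsCompact B) :
    ∃ C : Set ↥(unitaryGroupOfForm (starRingEnd ℂ) J), IsCompact C ∧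
      ∀ g : ↥(unitaryGroupOfForm (starRingEnd ℂ) J), g • e ∈ B → g ∈ C * (M : Set ↥(unitaryGroupOfForm (starRingEnd ℂ) J)) := by
  obtain ⟨𝒦, h𝒦, hmem⟩ := exists_isCompact_quotient_of_smul_mem hJ he M hM hB
  haveI : LocallyCompactSpace ↥(unitaryGroupOfForm (starRingEnd ℂ) J) := locallyCompactSpace_unitaryGroupOfForm_complex J
  obtain ⟨C, hC, hsub⟩ := Literature.MeasureTheory.Group.exists_isCompact_image_mk_superset M h𝒦
  refine ⟨C, hC, fun g hg => ?_⟩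
  obtain ⟨c, hc, hcg⟩ := hsub (hmem g hg)
  rw [QuotientGroup.eq] at hcg
  exact ⟨c, hc, c⁻¹ * g, hcg, by group⟩

/-- **`Stab(e)` centralises every `a·1 + b·e(eᴴJ)`** — in particular the semi-regular `s = ζ·(1 − E_e) + ζ′·E_e` whose centraliser `Z(s)` is the descent group `M`:
so `Stab(e) ≤ Z(s)` and §2–§3 apply with `M := Z(s)`.  (By the marker identity `g·e(eᴴJ)·g⁻¹ = (ge)((ge)ᴴJ) = e(eᴴJ)` for `ge = e`.)
[cite: Rogawski1990, §4.12 p. 66] [cite: Varadarajan1977, Part II §2] -/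
theorem stabilizer_le_centralizer_of_coe_eq {e : n → ℂ} (s : ↥(unitaryGroupOfForm (starRingEnd ℂ) J)) {a b : ℂ}
    (hs : ((s : GL n ℂ) : Matrix n n ℂ) = a • (1 : Matrix n n ℂ) + b • vecMulVec e (star e ᵥ* J)) :
    stabilizer ↥(unitaryGroupOfForm (starRingEnd ℂ) J) e ≤ Subgroup.centralizer ({s} : Set ↥(unitaryGroupOfForm (starRingEnd ℂ) J)) := by
  intro g hg
  rw [MulAction.mem_stabilizer_iff, subgroup_smul_vec_eq] at hg
  rw [Subgroup.mem_centralizer_singleton_iff]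
  -- matrices: `g S g⁻¹ = S`
  have hconj : ((g : GL n ℂ) : Matrix n n ℂ) * ((s : GL n ℂ) : Matrix n n ℂ) * (((g : GL n ℂ)⁻¹ : GL n ℂ) : Matrix n n ℂ) =
      ((s : GL n ℂ) : Matrix n n ℂ) := by
    rw [hs, Matrix.mul_add, Matrix.add_mul, Matrix.mul_smul, Matrix.smul_mul, Matrix.mul_one, Units.mul_inv, Matrix.mul_smul, Matrix.smul_mul,
      conj_vecMulVec_eq_of_mem g.2 e, hg]
  have hGL : (g : GL n ℂ) * (s : GL n ℂ) = (s : GL n ℂ) * (g : GL n ℂ) := by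
    refine Units.ext ?_
    calc ((g : GL n ℂ) * (s : GL n ℂ) : GL n ℂ).val
        = ((g : GL n ℂ) : Matrix n n ℂ) * ((s : GL n ℂ) : Matrix n n ℂ) * (((g : GL n ℂ)⁻¹ : GL n ℂ) : Matrix n n ℂ) * ((g : GL n ℂ) : Matrix n n ℂ) := by
          rw [Matrix.mul_assoc _ (((g : GL n ℂ)⁻¹ : GL n ℂ) : Matrix n n ℂ), Units.inv_mul, Matrix.mul_one, Units.val_mul]
      _ = ((s : GL n ℂ) * (g : GL n ℂ) : GL n ℂ).val := by rw [hconj, Units.val_mul]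
  exact Subtype.ext hGL

end Orbit

/-! ## §3 The compactness lemma: a conjugation-equivariant continuous marker pinning `E_e` on `S` ⇒ uniform properness modulo `M ≥ Stab(e)` on `S` -/

section Marker

variable {n : Type*} [Fintype n] [DecidableEq n] {J : Matrix n n ℂ}

/-- **HARISH-CHANDRA'S COMPACTNESS LEMMA AT A SEMI-REGULAR POINT ((HYP) form).**  Let `c : X → U(J)(ℂ)` be a chart and `e` a non-isotropic vector (`⟪e,e⟫ = eᴴJe ≠ 0`,
`J` hermitian with a right inverse).  Suppose that on `S ⊆ X` there is a marker `F : X → M_n(ℂ) → M_n(ℂ)`, jointly continuous on `S × M_n(ℂ)`, CONJUGATION-EQUIVARIANT under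
`U(J)(ℂ)` in the matrix variable, with `F x (c x) = E_e := ⟪e,e⟫⁻¹ · e(eᴴJ)` (the `J`-projector onto `ℂe`) for `x ∈ S` — e.g. the Lagrange eigenprojector polynomial of a
diagonal chart whose eigenvalue on `e` is simple on `S` (§4, `uniformlyProper_diagonal_of_ne`).  Then for EVERY subgroup `M ≥ Stab(e)` the chart is UNIFORMLY PROPER MODULO
`M` on `S`: for all compact `K ⊆ S`, `C ⊆ U(J)(ℂ)` one compact `𝒦 ⊆ U ⧸ M` contains `yM` whenever `y·c(x)·y⁻¹ ∈ C` for some `x ∈ K` — verbatim the (HYP) binder of ★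
`continuousOn_integral_descConj_of_uniformlyProper`.  (`y E_e y⁻¹ = F x (y c(x) y⁻¹)` ranges in the compact `F(K × C)`; by §1 `ye` is bounded; by §2 `yM` is confined.)
The walls of the OTHER eigenvalues inside `S` are allowed: this is what makes the lemma serve the semisimple descent at a singular `s ∈ c(S)` with `Z(s) = M`.
[cite: Rogawski1990, §4.12 Lemma 4.12.1 p. 66; §8.2 p. 114] [cite: HarishChandra1970, Part I §3 Lemma 22] [cite: Varadarajan1977, Part II §2] [cite: DeitmarEchterhoff2014, Lemma 9.3.3] -/
theorem uniformlyProper_of_marker (hJ : J.IsHermitian) {J' : Matrix n n ℂ} (hJJ' : J * J' = 1) {e : n → ℂ} (he : star e ⬝ᵥ J *ᵥ e ≠ 0)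
    (M : Subgroup ↥(unitaryGroupOfForm (starRingEnd ℂ) J)) (hM : stabilizer ↥(unitaryGroupOfForm (starRingEnd ℂ) J) e ≤ M)
    {X : Type*} [TopologicalSpace X] (c : X → ↥(unitaryGroupOfForm (starRingEnd ℂ) J)) {S : Set X}
    (F : X → Matrix n n ℂ → Matrix n n ℂ) (hF : ContinuousOn (fun p : X × Matrix n n ℂ => F p.1 p.2) (S ×ˢ univ))
    (hFeq : ∀ x ∈ S, ∀ (g : ↥(unitaryGroupOfForm (starRingEnd ℂ) J)) (m : Matrix n n ℂ),
      F x (((g : GL n ℂ) : Matrix n n ℂ) * m * (((g : GL n ℂ)⁻¹ : GL n ℂ) : Matrix n n ℂ)) =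
        ((g : GL n ℂ) : Matrix n n ℂ) * F x m * (((g : GL n ℂ)⁻¹ : GL n ℂ) : Matrix n n ℂ))
    (hFc : ∀ x ∈ S, F x (((c x : ↥(unitaryGroupOfForm (starRingEnd ℂ) J)) : GL n ℂ) : Matrix n n ℂ) = (star e ⬝ᵥ J *ᵥ e)⁻¹ • vecMulVec e (star e ᵥ* J)) :
    ∀ K ⊆ S, IsCompact K → ∀ C : Set ↥(unitaryGroupOfForm (starRingEnd ℂ) J), IsCompact C →
      ∃ 𝒦 : Set (↥(unitaryGroupOfForm (starRingEnd ℂ) J) ⧸ M), IsCompact 𝒦 ∧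
        ∀ x ∈ K, ∀ y : ↥(unitaryGroupOfForm (starRingEnd ℂ) J), y * c x * y⁻¹ ∈ C → (QuotientGroup.mk y : ↥(unitaryGroupOfForm (starRingEnd ℂ) J) ⧸ M) ∈ 𝒦 := by
  intro K hKS hK C hC
  -- the compact set of marker values `⟪e,e⟫ • F(K × C)`
  have hcoe : Continuous fun y : ↥(unitaryGroupOfForm (starRingEnd ℂ) J) => ((y : GL n ℂ) : Matrix n n ℂ) :=
    Units.continuous_val.comp continuous_subtype_val
  set 𝒞 : Set (Matrix n n ℂ) := (fun p : X × Matrix n n ℂ => (star e ⬝ᵥ J *ᵥ e) • F p.1 p.2) ''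
    (K ×ˢ ((fun y : ↥(unitaryGroupOfForm (starRingEnd ℂ) J) => ((y : GL n ℂ) : Matrix n n ℂ)) '' C)) with h𝒞def
  have hF' : ContinuousOn (fun p : X × Matrix n n ℂ => (star e ⬝ᵥ J *ᵥ e) • F p.1 p.2) (S ×ˢ univ) :=
    ContinuousOn.smul (f := fun _ : X × Matrix n n ℂ => star e ⬝ᵥ J *ᵥ e) (g := fun p : X × Matrix n n ℂ => F p.1 p.2) continuousOn_const hF
  have h𝒞 : IsCompact 𝒞 :=
    (hK.prod (hC.image hcoe)).image_of_continuousOn (hF'.mono (Set.prod_mono hKS (Set.subset_univ _)))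
  obtain ⟨R, _, hR⟩ := exists_forall_norm_le_of_vecMulVec_mem hJJ' h𝒞
  obtain ⟨𝒦, h𝒦, hmem⟩ := exists_isCompact_quotient_of_smul_mem hJ he M hM (isCompact_closedBall (0 : n → ℂ) R)
  refine ⟨𝒦, h𝒦, fun x hx y hy => hmem y ?_⟩
  rw [Metric.mem_closedBall, dist_zero_right, subgroup_smul_vec_eq]
  refine hR _ ⟨(x, (((y * c x * y⁻¹ : ↥(unitaryGroupOfForm (starRingEnd ℂ) J)) : GL n ℂ) : Matrix n n ℂ)), ⟨hx, _, hy, rfl⟩, ?_⟩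
  -- `⟪e,e⟫ • F x (y c(x) y⁻¹) = (ye)((ye)ᴴ J)`
  have hconj : (((y * c x * y⁻¹ : ↥(unitaryGroupOfForm (starRingEnd ℂ) J)) : GL n ℂ) : Matrix n n ℂ) =
      ((y : GL n ℂ) : Matrix n n ℂ) * (((c x : ↥(unitaryGroupOfForm (starRingEnd ℂ) J)) : GL n ℂ) : Matrix n n ℂ) *
        (((y : GL n ℂ)⁻¹ : GL n ℂ) : Matrix n n ℂ) := by
    rw [Subgroup.coe_mul, Subgroup.coe_mul, Subgroup.coe_inv, Units.val_mul, Units.val_mul]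
  simp only [hconj, hFeq x (hKS hx), hFc x (hKS hx), Matrix.mul_smul, Matrix.smul_mul, smul_smul, mul_inv_cancel₀ he, one_smul]
  exact conj_vecMulVec_eq_of_mem y.2 e

/-- **Group-level form** of the compactness lemma (the `hCM` binder of ★ `orbitalIntegral_eq_orbitalIntegral_descended`, UNIFORM in `x ∈ K`): one compact `C′ ⊆ U(J)(ℂ)` with
`y ∈ C′·M` whenever `y·c(x)·y⁻¹ ∈ C`, `x ∈ K`. [cite: Rogawski1990, §4.12 Lemma 4.12.1 p. 66] [cite: HarishChandra1970, Part I §3 Lemma 22] [cite: Rogawski1990, §8.2 p. 114] -/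
theorem exists_isCompact_mul_of_marker (hJ : J.IsHermitian) {J' : Matrix n n ℂ} (hJJ' : J * J' = 1) {e : n → ℂ} (he : star e ⬝ᵥ J *ᵥ e ≠ 0)
    (M : Subgroup ↥(unitaryGroupOfForm (starRingEnd ℂ) J)) (hM : stabilizer ↥(unitaryGroupOfForm (starRingEnd ℂ) J) e ≤ M)
    {X : Type*} [TopologicalSpace X] (c : X → ↥(unitaryGroupOfForm (starRingEnd ℂ) J)) {S : Set X}
    (F : X → Matrix n n ℂ → Matrix n n ℂ) (hF : ContinuousOn (fun p : X × Matrix n n ℂ => F p.1 p.2) (S ×ˢ univ))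
    (hFeq : ∀ x ∈ S, ∀ (g : ↥(unitaryGroupOfForm (starRingEnd ℂ) J)) (m : Matrix n n ℂ),
      F x (((g : GL n ℂ) : Matrix n n ℂ) * m * (((g : GL n ℂ)⁻¹ : GL n ℂ) : Matrix n n ℂ)) =
        ((g : GL n ℂ) : Matrix n n ℂ) * F x m * (((g : GL n ℂ)⁻¹ : GL n ℂ) : Matrix n n ℂ))
    (hFc : ∀ x ∈ S, F x (((c x : ↥(unitaryGroupOfForm (starRingEnd ℂ) J)) : GL n ℂ) : Matrix n n ℂ) = (star e ⬝ᵥ J *ᵥ e)⁻¹ • vecMulVec e (star e ᵥ* J))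
    {K : Set X} (hKS : K ⊆ S) (hK : IsCompact K) {C : Set ↥(unitaryGroupOfForm (starRingEnd ℂ) J)} (hC : IsCompact C) :
    ∃ C' : Set ↥(unitaryGroupOfForm (starRingEnd ℂ) J), IsCompact C' ∧
      ∀ x ∈ K, ∀ y : ↥(unitaryGroupOfForm (starRingEnd ℂ) J), y * c x * y⁻¹ ∈ C → y ∈ C' * (M : Set ↥(unitaryGroupOfForm (starRingEnd ℂ) J)) := by
  obtain ⟨𝒦, h𝒦, hmem⟩ := uniformlyProper_of_marker hJ hJJ' he M hM c F hF hFeq hFc K hKS hK C hC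
  haveI : LocallyCompactSpace ↥(unitaryGroupOfForm (starRingEnd ℂ) J) := locallyCompactSpace_unitaryGroupOfForm_complex J
  obtain ⟨C', hC', hsub⟩ := Literature.MeasureTheory.Group.exists_isCompact_image_mk_superset M h𝒦
  refine ⟨C', hC', fun x hx y hy => ?_⟩
  obtain ⟨a, ha, hay⟩ := hsub (hmem x hx y hy)
  rw [QuotientGroup.eq] at hay
  exact ⟨a, ha, a⁻¹ * y, hay, by group⟩

end Marker



end Literature.NumberTheory.Automorphic.UnitaryGroup
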